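import Mathlib
import HarnessLib
import Summits.Ventures.LatticeQCDFlow.Exactness.IMHKernel
import Summits.Ventures.LatticeQCDFlow.Exactness.MetropolisSweepInstances
import Summits.Ventures.LatticeQCDFlow.Exactness.EngineHMCTranslationCovariance
import Summits.Ventures.LatticeQCDFlow.Exactness.KernelCouplingTranslation

/-!
# The flow sampler inherits the symmetries of its data: `indepMH (Ψ_* Haar^⊗) (e^{−βS}·(J∘Ψ⁻¹))` commutes with every lattice translation the flow intertwines — so its law is translation invariant at EVERY step, not only at equilibrium

HONEST FRAMING: exact (Metropolis-corrected) sampling algorithms for lattice gauge theory;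
figures of merit are autocorrelation/cost numbers at stated couplings and volumes; no
continuum-physics claim.

Venture `LatticeQCDFlow` (cell pub-lqcd), topic `Exactness`; FANOUT row 10 (`eng-equiv`, engine
`latflow.equiv` / `latflow.flows_jax`: the FLOW SAMPLER = gauge-equivariant flow proposals
`U' = Ψ(V)`, `V ∼ Haar^⊗`, accepted with `min(1, w(U')/w(U))`, `w = e^{−βS_W}·(J∘Ψ⁻¹)` —
`equiv/imh.py`, `flows_jax/*_flow.make_proposer`; acceptance suite: "translation covariance
0.0e+00" of the presets).  NEW WORK of the cell; nothing is cited as a fact; no number; no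
definition is introduced.  Row 14 typed "the FT-HMC kernel commutes with every symmetry of its
data" (`KernelSymmetry`, `FTHMCKernelCovariance`) and rows 9 / 21 the same for the engine's HMC
(`EngineHMCTranslationCovariance`); the cell's `FlowSamplerOddObservableExact` /
`FlowSamplerSymmetrisation` files ASSUME a symmetric flow and work at equilibrium.  This file is the
flow sampler's kernel-level counterpart and discharges the assumption for row 10's flows under
LATTICE TRANSLATIONS, using GEN-15's `KernelCouplingTranslation` (`F (V·t) = (F V)·t` for row 10's
layers, `HasJacobian.jac_siteTranslate_eq`: `J (V·t) = J V` for every continuous exact Jacobian).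

## What is typed

* §1 (any measurable space) **`conjKernel_indepMH_eq_self`** — the independence-Metropolis kernel
  `indepMH q w` (row 30's `IMHKernel`) commutes with every `Θ : Ω ≃ᵐ Ω` preserving the model law
  `q` and the importance weight `w` (`imhAcceptE_symm`, `imhAcceptMass_symm`: acceptance
  probability and acceptance mass are `Θ`-invariant); `map_map_eq_self_of_comm` — the MODEL LAW
  `Ψ_* π₀` inherits every symmetry of the prior that the flow intertwines; `flowWeight_symm` — so
  does the weight `g · (J ∘ Ψ⁻¹)`; assembled: **`conjKernel_flowSampler_eq_self`**;
* §2 (lattice, any measurable group `G`, any probability one-link law) —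
  **`conjKernel_flowSampler_configTranslate`**: a flow `Ψ : G^E ≃ᵐ G^E` with
  `Ψ (V·v) = (Ψ V)·v`, a translation-invariant target weight `g` and Jacobian `J` give a flow
  sampler commuting with `configTranslate v`; **`conjKernel_wilsonFlowSampler_configTranslate`** —
  for the Wilson target `e^{−βS_W}` (any continuous unitary-matrix representation, compact
  second-countable `G`) and a CONTINUOUS exact Jacobian the only hypothesis left is
  `Ψ (V·v) = (Ψ V)·v` (`wilsonAction_configTranslate` + `HasJacobian.jac_siteTranslate_eq`);
* §3 (out of equilibrium) — from any `T_v`-invariant start (hot start `Haar^⊗`, the model law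
  `Ψ_* Haar^⊗` itself = the engine's start "accept the first proposal", the cold start) the law of
  the flow-sampler run is `T_v`-invariant at EVERY step (`wilsonFlowSampler_law_map_configTranslate`,
  iterate form `…_iterate_…`), hence plaquette one-point functions satisfy
  `E_t[φ(U_{x;ij})] = E_t[φ(U_{x+v;ij})]` at every step
  (`integral_wilsonFlowSampler_plaquette_configTranslate`) — for the translations `v` the flow
  intertwines, NOT for all `v`: a masked flow commutes with the width sublattice only
  (`stripesPhase_apply_eq_zero`), so out of equilibrium the one-point functions have the period of
  the MASK; at equilibrium full invariance returns (`wilsonMeasure_map_configTranslate`);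
* the `SU(N)` STOUT FLOW SAMPLER of `SUNStoutFlowSamplerErgodic` (its kernel commutes with every
  mask-preserving translation, every `N`, `d`, `L`) is the sequel `SUNStoutFlowSamplerTranslation`
  (one `rw` with GEN-15's `sunStoutLayer_siteTranslate` into §2).

NOT here: gauge transformations and charge conjugation of the flow sampler (sequel files); which
translations preserve a given conditioner's outputs (hypothesis, as in `KernelCouplingTranslation`);
any number.
-/

noncomputable section

namespace Summit.Ventures.LatticeQCDFlow.Exactness

open MeasureTheory ProbabilityTheory ProbabilityTheory.Kernel Set
open Literature.MathematicalPhysics.QuantumFieldTheory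
open Literature.MathematicalPhysics.QuantumFieldTheory.Luscher2010
open scoped ENNReal Matrix

/-! ## §1 The independence-Metropolis kernel commutes with every symmetry of `(q, w)` -/

section Generic

variable {Ω : Type*} [MeasurableSpace Ω]

omit [MeasurableSpace Ω] in
/-- The acceptance probability `min(1, w y / w x)` is invariant under a simultaneous symmetry of
`w`. -/
theorem imhAcceptE_symm {w : Ω → ℝ} {Θ : Ω → Ω} (hw : ∀ x, w (Θ x) = w x) (x y : Ω) :
    imhAcceptE w (Θ x) (Θ y) = imhAcceptE w x y := by
  simp only [imhAcceptE, imhAccept, hw]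

/-- The acceptance mass `A(x) = ∫ min(1, w y / w x) q(dy)` is `Θ`-invariant when `Θ` preserves `q`
and `w`. -/
theorem imhAcceptMass_symm {q : Measure Ω} {w : Ω → ℝ} (hwm : Measurable w) (Θ : Ω ≃ᵐ Ω)
    (hq : MeasurePreserving Θ q q) (hw : ∀ x, w (Θ x) = w x) (x : Ω) :
    imhAcceptMass q w (Θ x) = imhAcceptMass q w x := by
  unfold imhAcceptMass
  have hmeas : Measurable fun y => imhAcceptE w (Θ x) y :=
    (measurable_imhAcceptE hwm).comp (measurable_const.prodMk measurable_id)
  rw [← hq.lintegral_comp hmeas]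
  simp only [imhAcceptE_symm hw]

/-- **The flow-MCMC (independence Metropolis) kernel commutes with every symmetry of its data**:
`Θ_* q = q` and `w ∘ Θ = w` give `conjKernel (indepMH q w) Θ = indepMH q w`. -/
theorem conjKernel_indepMH_eq_self {q : Measure Ω} [IsProbabilityMeasure q] {w : Ω → ℝ}
    (hwm : Measurable w) (Θ : Ω ≃ᵐ Ω) (hq : MeasurePreserving Θ q q) (hw : ∀ x, w (Θ x) = w x) :
    conjKernel (indepMH q w) Θ = indepMH q w := by
  ext x B hB
  rw [conjKernel_apply' _ _ _ hB, indepMH_apply hwm _ (Θ.measurable hB), indepMH_apply hwm _ hB]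
  have hΘx : Θ (Θ.symm x) = x := Θ.apply_symm_apply x
  -- the proposal part: change variables `y = Θ y'` in the `q`-integral
  have h1 : ∀ y, imhAcceptE w (Θ.symm x) y = imhAcceptE w x (Θ y) := fun y => by
    rw [← imhAcceptE_symm hw (Θ.symm x) y, hΘx]
  have hmeas : Measurable fun y => imhAcceptE w x y :=
    (measurable_imhAcceptE hwm).comp (measurable_const.prodMk measurable_id)
  have hint : ∫⁻ y in Θ ⁻¹' B, imhAcceptE w (Θ.symm x) y ∂q = ∫⁻ y in B, imhAcceptE w x y ∂q := by
    simp only [h1]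
    exact hq.setLIntegral_comp_preimage hB hmeas
  -- the rejection part
  have hmass : imhAcceptMass q w (Θ.symm x) = imhAcceptMass q w x := by
    rw [← imhAcceptMass_symm hwm Θ hq hw (Θ.symm x), hΘx]
  have hind : (Θ ⁻¹' B).indicator (1 : Ω → ℝ≥0∞) (Θ.symm x) = B.indicator 1 x := by
    by_cases h : x ∈ B
    · rw [Set.indicator_of_mem (show Θ.symm x ∈ Θ ⁻¹' B by rw [Set.mem_preimage, hΘx]; exact h),
        Set.indicator_of_mem h]
      rfl
    · rw [Set.indicator_of_notMem (fun h' => h (by rwa [Set.mem_preimage, hΘx] at h')),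
        Set.indicator_of_notMem h]
  rw [hint, hmass, hind]

/-- **The flow's MODEL LAW inherits every symmetry of the prior that the flow intertwines**:
`Θ_* π₀ = π₀` and `Ψ ∘ Θ = Θ ∘ Ψ` give `Θ_* (Ψ_* π₀) = Ψ_* π₀`. -/
theorem map_map_eq_self_of_comm {π₀ : Measure Ω} {Ψ : Ω → Ω} (hΨ : Measurable Ψ) (Θ : Ω ≃ᵐ Ω)
    (hπ₀ : π₀.map Θ = π₀) (hcomm : ∀ x, Ψ (Θ x) = Θ (Ψ x)) :
    (π₀.map Ψ).map Θ = π₀.map Ψ := by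
  rw [Measure.map_map Θ.measurable hΨ,
    show (Θ : Ω → Ω) ∘ Ψ = Ψ ∘ Θ from funext fun x => (hcomm x).symm,
    ← Measure.map_map hΨ Θ.measurable, hπ₀]

/-- The same as a `MeasurePreserving` statement. -/
theorem measurePreserving_map_of_comm {π₀ : Measure Ω} {Ψ : Ω → Ω} (hΨ : Measurable Ψ)
    (Θ : Ω ≃ᵐ Ω) (hπ₀ : MeasurePreserving Θ π₀ π₀) (hcomm : ∀ x, Ψ (Θ x) = Θ (Ψ x)) :
    MeasurePreserving Θ (π₀.map Ψ) (π₀.map Ψ) :=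
  ⟨Θ.measurable, map_map_eq_self_of_comm hΨ Θ hπ₀.map_eq hcomm⟩

omit [MeasurableSpace Ω] in
/-- A bijection commuting with `Θ` has an inverse commuting with `Θ`. -/
theorem equiv_symm_comm {Ψ Θ : Ω ≃ Ω} (hcomm : ∀ x, Ψ (Θ x) = Θ (Ψ x)) (x : Ω) :
    Ψ.symm (Θ x) = Θ (Ψ.symm x) := by
  apply Ψ.injective
  rw [Ψ.apply_symm_apply, hcomm, Ψ.apply_symm_apply]

/-- **The importance weight `w = g · (J ∘ Ψ⁻¹)` (target weight over model density, the quantity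
the code evaluates) is `Θ`-invariant** when `g` and `J` are and the flow commutes with `Θ`. -/
theorem flowWeight_symm {Ψ Θ : Ω ≃ᵐ Ω} {g J : Ω → ℝ} (hcomm : ∀ x, Ψ (Θ x) = Θ (Ψ x))
    (hg : ∀ x, g (Θ x) = g x) (hJ : ∀ x, J (Θ x) = J x) (x : Ω) :
    g (Θ x) * J (Ψ.symm (Θ x)) = g x * J (Ψ.symm x) := by
  have hsymm : Ψ.symm (Θ x) = Θ (Ψ.symm x) :=
    equiv_symm_comm (Ψ := Ψ.toEquiv) (Θ := Θ.toEquiv) hcomm x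
  rw [hg, hsymm, hJ]

/-- **ASSEMBLY — the flow sampler commutes with every symmetry of its data.**  Prior `π₀` with
`Θ_* π₀ = π₀`, flow `Ψ` with `Ψ ∘ Θ = Θ ∘ Ψ`, target weight `g` and Jacobian `J` both
`Θ`-invariant and measurable: the kernel "propose `Ψ_* π₀`, accept with
`min(1, w(U')/w(U))`, `w = g · (J ∘ Ψ⁻¹)`" satisfies `conjKernel K Θ = K`. -/
theorem conjKernel_flowSampler_eq_self {π₀ : Measure Ω} [IsProbabilityMeasure π₀] (Ψ Θ : Ω ≃ᵐ Ω)
    {g J : Ω → ℝ} (hgm : Measurable g) (hJm : Measurable J) (hπ₀ : MeasurePreserving Θ π₀ π₀)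
    (hcomm : ∀ x, Ψ (Θ x) = Θ (Ψ x)) (hg : ∀ x, g (Θ x) = g x) (hJ : ∀ x, J (Θ x) = J x) :
    haveI : IsProbabilityMeasure (π₀.map Ψ) :=
      Measure.isProbabilityMeasure_map Ψ.measurable.aemeasurable
    conjKernel (indepMH (π₀.map Ψ) (fun x => g x * J (Ψ.symm x))) Θ =
      indepMH (π₀.map Ψ) (fun x => g x * J (Ψ.symm x)) := by
  haveI : IsProbabilityMeasure (π₀.map Ψ) :=
    Measure.isProbabilityMeasure_map Ψ.measurable.aemeasurable
  exact conjKernel_indepMH_eq_self (hgm.mul (hJm.comp Ψ.symm.measurable)) Θ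
    (measurePreserving_map_of_comm Ψ.measurable Θ hπ₀ hcomm) (flowWeight_symm hcomm hg hJ)

/-- **Out of equilibrium**: from a `Θ`-invariant start the law of a `Θ`-symmetric run is
`Θ`-invariant at every step — in the iterate spelling `(· .bind K)^[t] μ₀` of
`SUNStoutFlowSamplerErgodic`. -/
theorem iterate_bind_map_eq_self_of_conjKernel_eq_self {κ : Kernel Ω Ω} {Θ : Ω ≃ᵐ Ω}
    (hκ : conjKernel κ Θ = κ) {μ₀ : Measure Ω} (hμ₀ : μ₀.map Θ = μ₀) (t : ℕ) :
    ((fun m : Measure Ω => m.bind κ)^[t] μ₀).map Θ = (fun m : Measure Ω => m.bind κ)^[t] μ₀ := by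
  induction t with
  | zero => simpa using hμ₀
  | succ t ih =>
    rw [Function.iterate_succ_apply', Scoring.map_bind_eq_bind_conjKernel, hκ, ih]

end Generic

/-! ## §2 Lattice translations: any group, any one-link law; the Wilson target -/

section Lattice

variable {d L : ℕ} [NeZero L] {G : Type*} [MeasurableSpace G]

/-- **A translation-equivariant flow gives a translation-symmetric flow sampler** (any measurable
`G`, any probability one-link law `ν`, any translation-invariant measurable target weight `g` and
Jacobian `J`): `conjKernel K (T_v) = K` for
`K = indepMH (Ψ_* ν^⊗) (g · (J ∘ Ψ⁻¹))`. -/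
theorem conjKernel_flowSampler_configTranslate (ν : Measure G) [IsProbabilityMeasure ν]
    (Ψ : GaugeConfig d L G ≃ᵐ GaugeConfig d L G) {g J : GaugeConfig d L G → ℝ}
    (hgm : Measurable g) (hJm : Measurable J) (v : Site d L)
    (hΨ : ∀ V : GaugeConfig d L G, Ψ (GaugeConfig.siteTranslate v V) = GaugeConfig.siteTranslate v (Ψ V))
    (hg : ∀ V : GaugeConfig d L G, g (GaugeConfig.siteTranslate v V) = g V)
    (hJ : ∀ V : GaugeConfig d L G, J (GaugeConfig.siteTranslate v V) = J V) :
    haveI : IsProbabilityMeasure ((Measure.pi fun _ : Edge d L => ν).map Ψ) :=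
      Measure.isProbabilityMeasure_map Ψ.measurable.aemeasurable
    conjKernel (indepMH ((Measure.pi fun _ : Edge d L => ν).map Ψ) (fun U => g U * J (Ψ.symm U)))
        (configTranslate v) =
      indepMH ((Measure.pi fun _ : Edge d L => ν).map Ψ) (fun U => g U * J (Ψ.symm U)) := by
  refine conjKernel_flowSampler_eq_self Ψ (configTranslate v) hgm hJm
    (measurePreserving_configTranslate v ν) (fun V => ?_) (fun V => ?_) (fun V => ?_)
  · rw [configTranslate_eq_siteTranslate, configTranslate_eq_siteTranslate, hΨ]
  · rw [configTranslate_eq_siteTranslate, hg]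
  · rw [configTranslate_eq_siteTranslate, hJ]

variable [Group G] [TopologicalSpace G] [IsTopologicalGroup G] [CompactSpace G]
  [SecondCountableTopology G] [BorelSpace G] {N : ℕ}

/-- **The WILSON flow sampler with a continuous exact Jacobian commutes with every translation the
flow intertwines** — compact second-countable `G`, product Haar prior, target `e^{−βS_W}` for any
continuous matrix representation `ρ`, `J ≥ 0` continuous with `HasJacobian (Haar^⊗) Ψ (ofReal ∘ J)`:
the hypotheses `g ∘ T_v = g` and `J ∘ T_v = J` of `conjKernel_flowSampler_configTranslate` are
DISCHARGED (`wilsonAction_configTranslate`, GEN-15's `HasJacobian.jac_siteTranslate_eq`). -/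
theorem conjKernel_wilsonFlowSampler_configTranslate (ρ : G →* Matrix (Fin N) (Fin N) ℂ)
    (hρ : Continuous ρ) (β : ℝ) (Ψ : GaugeConfig d L G ≃ᵐ GaugeConfig d L G)
    {J : GaugeConfig d L G → ℝ} (hJc : Continuous J) (hJ0 : ∀ U, 0 ≤ J U)
    (hJac : HasJacobian (Measure.pi fun _ : Edge d L => haarProbability G) Ψ
      (fun U => ENNReal.ofReal (J U)))
    (v : Site d L)
    (hΨ : ∀ V : GaugeConfig d L G, Ψ (GaugeConfig.siteTranslate v V) = GaugeConfig.siteTranslate v (Ψ V)) :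
    haveI : IsProbabilityMeasure ((Measure.pi fun _ : Edge d L => haarProbability G).map Ψ) :=
      Measure.isProbabilityMeasure_map Ψ.measurable.aemeasurable
    conjKernel (indepMH ((Measure.pi fun _ : Edge d L => haarProbability G).map Ψ)
        (fun U => Real.exp (-β * wilsonAction ρ U) * J (Ψ.symm U))) (configTranslate v) =
      indepMH ((Measure.pi fun _ : Edge d L => haarProbability G).map Ψ)
        (fun U => Real.exp (-β * wilsonAction ρ U) * J (Ψ.symm U)) := by
  obtain ⟨_, -, -, hgm⟩ := wilsonBoltzmann_pinched (d := d) (L := L) ρ hρ β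
  refine conjKernel_flowSampler_configTranslate (haarProbability G) Ψ hgm hJc.measurable v hΨ
    (fun V => ?_) (fun V => HasJacobian.jac_siteTranslate_eq v hΨ hJc hJ0 hJac V)
  rw [← configTranslate_eq_siteTranslate, wilsonAction_configTranslate]

/-! ## §3 Out of equilibrium: translation-invariant laws along the run; one-point functions at every step -/

omit [SecondCountableTopology G] in
/-- The model law `Ψ_* Haar^⊗` — the engine's START ("accept the first proposal") — is invariant
under every translation the flow intertwines. -/
theorem flowModel_map_configTranslate (Ψ : GaugeConfig d L G ≃ᵐ GaugeConfig d L G) (v : Site d L)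
    (hΨ : ∀ V : GaugeConfig d L G, Ψ (GaugeConfig.siteTranslate v V) = GaugeConfig.siteTranslate v (Ψ V)) :
    ((Measure.pi fun _ : Edge d L => haarProbability G).map Ψ).map (configTranslate v) =
      (Measure.pi fun _ : Edge d L => haarProbability G).map Ψ :=
  map_map_eq_self_of_comm Ψ.measurable (configTranslate v)
    (measurePreserving_configTranslate v (haarProbability G)).map_eq
    (fun V => by rw [configTranslate_eq_siteTranslate, configTranslate_eq_siteTranslate, hΨ])

/-- **At every step `t` the law of the Wilson flow-sampler run from a `T_v`-invariant start is
`T_v`-invariant** (`nHit` spelling). -/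
theorem wilsonFlowSampler_law_map_configTranslate (ρ : G →* Matrix (Fin N) (Fin N) ℂ)
    (hρ : Continuous ρ) (β : ℝ) (Ψ : GaugeConfig d L G ≃ᵐ GaugeConfig d L G)
    {J : GaugeConfig d L G → ℝ} (hJc : Continuous J) (hJ0 : ∀ U, 0 ≤ J U)
    (hJac : HasJacobian (Measure.pi fun _ : Edge d L => haarProbability G) Ψ
      (fun U => ENNReal.ofReal (J U)))
    (v : Site d L)
    (hΨ : ∀ V : GaugeConfig d L G, Ψ (GaugeConfig.siteTranslate v V) = GaugeConfig.siteTranslate v (Ψ V))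
    {μ₀ : Measure (GaugeConfig d L G)} (hμ₀ : μ₀.map (configTranslate v) = μ₀) (t : ℕ) :
    haveI : IsProbabilityMeasure ((Measure.pi fun _ : Edge d L => haarProbability G).map Ψ) :=
      Measure.isProbabilityMeasure_map Ψ.measurable.aemeasurable
    (μ₀.bind (nHit (indepMH ((Measure.pi fun _ : Edge d L => haarProbability G).map Ψ)
        (fun U => Real.exp (-β * wilsonAction ρ U) * J (Ψ.symm U))) t)).map (configTranslate v) =
      μ₀.bind (nHit (indepMH ((Measure.pi fun _ : Edge d L => haarProbability G).map Ψ)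
        (fun U => Real.exp (-β * wilsonAction ρ U) * J (Ψ.symm U))) t) :=
  Scoring.map_bind_nHit_eq_self
    (conjKernel_wilsonFlowSampler_configTranslate ρ hρ β Ψ hJc hJ0 hJac v hΨ) hμ₀ t

/-- The same in the iterate spelling `(· .bind K)^[t] μ₀` of `SUNStoutFlowSamplerErgodic`. -/
theorem wilsonFlowSampler_iterate_law_map_configTranslate (ρ : G →* Matrix (Fin N) (Fin N) ℂ)
    (hρ : Continuous ρ) (β : ℝ) (Ψ : GaugeConfig d L G ≃ᵐ GaugeConfig d L G)
    {J : GaugeConfig d L G → ℝ} (hJc : Continuous J) (hJ0 : ∀ U, 0 ≤ J U)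
    (hJac : HasJacobian (Measure.pi fun _ : Edge d L => haarProbability G) Ψ
      (fun U => ENNReal.ofReal (J U)))
    (v : Site d L)
    (hΨ : ∀ V : GaugeConfig d L G, Ψ (GaugeConfig.siteTranslate v V) = GaugeConfig.siteTranslate v (Ψ V))
    {μ₀ : Measure (GaugeConfig d L G)} (hμ₀ : μ₀.map (configTranslate v) = μ₀) (t : ℕ) :
    haveI : IsProbabilityMeasure ((Measure.pi fun _ : Edge d L => haarProbability G).map Ψ) :=
      Measure.isProbabilityMeasure_map Ψ.measurable.aemeasurable
    ((fun m : Measure (GaugeConfig d L G) =>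
        m.bind (indepMH ((Measure.pi fun _ : Edge d L => haarProbability G).map Ψ)
          (fun U => Real.exp (-β * wilsonAction ρ U) * J (Ψ.symm U))))^[t] μ₀).map (configTranslate v) =
      (fun m : Measure (GaugeConfig d L G) =>
        m.bind (indepMH ((Measure.pi fun _ : Edge d L => haarProbability G).map Ψ)
          (fun U => Real.exp (-β * wilsonAction ρ U) * J (Ψ.symm U))))^[t] μ₀ :=
  iterate_bind_map_eq_self_of_conjKernel_eq_self
    (conjKernel_wilsonFlowSampler_configTranslate ρ hρ β Ψ hJc hJ0 hJac v hΨ) hμ₀ t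

/-- **Plaquette one-point functions along the run are invariant under the translations the flow
intertwines, at every step**: `E_t[φ(U_{x;ij})] = E_t[φ(U_{v+x;ij})]` from any `T_v`-invariant start
— for a MASKED flow these `v` form the width sublattice (`stripesPhase_apply_eq_zero`), not the
whole lattice; at equilibrium full invariance returns (`wilsonMeasure_map_configTranslate`). -/
theorem integral_wilsonFlowSampler_plaquette_configTranslate (ρ : G →* Matrix (Fin N) (Fin N) ℂ)
    (hρ : Continuous ρ) (β : ℝ) (Ψ : GaugeConfig d L G ≃ᵐ GaugeConfig d L G)
    {J : GaugeConfig d L G → ℝ} (hJc : Continuous J) (hJ0 : ∀ U, 0 ≤ J U)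
    (hJac : HasJacobian (Measure.pi fun _ : Edge d L => haarProbability G) Ψ
      (fun U => ENNReal.ofReal (J U)))
    (v : Site d L)
    (hΨ : ∀ V : GaugeConfig d L G, Ψ (GaugeConfig.siteTranslate v V) = GaugeConfig.siteTranslate v (Ψ V))
    {μ₀ : Measure (GaugeConfig d L G)} (hμ₀ : μ₀.map (configTranslate v) = μ₀) (t : ℕ)
    {F : Type*} [NormedAddCommGroup F] [NormedSpace ℝ F] (φ : G → F) (i j : Fin d) (x : Site d L) :
    haveI : IsProbabilityMeasure ((Measure.pi fun _ : Edge d L => haarProbability G).map Ψ) :=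
      Measure.isProbabilityMeasure_map Ψ.measurable.aemeasurable
    ∫ U, φ (plaquetteHolonomy U x i j) ∂(μ₀.bind (nHit (indepMH
        ((Measure.pi fun _ : Edge d L => haarProbability G).map Ψ)
        (fun U => Real.exp (-β * wilsonAction ρ U) * J (Ψ.symm U))) t)) =
      ∫ U, φ (plaquetteHolonomy U (v + x) i j) ∂(μ₀.bind (nHit (indepMH
        ((Measure.pi fun _ : Edge d L => haarProbability G).map Ψ)
        (fun U => Real.exp (-β * wilsonAction ρ U) * J (Ψ.symm U))) t)) := by
  have h := (MeasurePreserving.mk (configTranslate v).measurable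
    (wilsonFlowSampler_law_map_configTranslate ρ hρ β Ψ hJc hJ0 hJac v hΨ hμ₀ t)).integral_comp'
    (fun U => φ (plaquetteHolonomy U x i j))
  simp only [plaquetteHolonomy_configTranslate] at h
  exact h.symm

end Lattice

end Summit.Ventures.LatticeQCDFlow.Exactness

end
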